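import Mathlib
import HarnessLib
import Summits.AtomisticToContinuum.FouriersLaw.Theses.BondHeatUncertainty
import Literature.MathematicalPhysics.KineticTheory.FouriersLaw
import Literature.MathematicalPhysics.KineticTheory.LangevinChainKernel
import Literature.MathematicalPhysics.KineticTheory.LangevinChainGibbs

/-!
# Sketch — first lemmas of crux idea `odd-density-dual-correctors` for `LinearResponseFTUR`
(stmt-AtomisticToContinuum-9122; crux-ideate round 1, ideator 1, gen 2)

The NESS half of every perturbative (Gram / Cauchy–Schwarz) line on (★). Two levers, stated over
existing declarations only:

* `OddSnapshotCauchySchwarz` — Cauchy–Schwarz against the Θ-SYMMETRISED snapshot: for a probability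
  measure `μ` on phase space and a Θ-odd `φ ∈ L²(μ)`,
  `(∫ φ dμ)² ≤ ½ · KL(μ ‖ Θ_*μ) · ∫ φ² dμ` (odd density `a = dμ/dμˢ - 1 ∈ [-1,1]`,
  `μˢ = ½(μ + Θ_*μ)`, `KL = ∫ 2a·artanh a dμˢ ≥ 2∫ a² dμˢ`, `∫ φ dμ = ∫ φ a dμˢ`). Provable now.
* `DualResponseLimit` — response WITHOUT response theory: along a weak steady-state family, for every
  smooth `F` with `e^{θH}`-bounded 2-jet, `(1/δ) ∫ L_T F dμ_{N,T+δ/2,T-δ/2} → -(γ/2T²) ∫ F (p_0² - p_{N-1}²) dμ_T`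
  (weak stationarity tested on `F`: `L_T F = L_δ F - (γδ/2)(∂²_{p_0} - ∂²_{p_{N-1}})F`; then `μ_δ ⇀ μ_T`
  and Gaussian integration by parts in the bath momenta).
Fed with the first corrector (`L_T U_b = -j_b/T²`, `F = -T² Σ_b U_b`) it identifies `D_N`; fed with the
second corrector (`L_T Z_b = U_b - U_b∘Θ`) and `OddSnapshotCauchySchwarz` it turns the crux's KL hypothesis
into `K ≥ ½‖U_b - U_b∘Θ‖²`. Exact rational check on the harmonic member: planner folder
`checks/dual_corrector_check.py` (g = g_dual = G_N, k = c_Z = K_N at every bond, N = 2..5).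
-/

namespace Summit.AtomisticToContinuum.FouriersLaw.Cruxes.LinearResponseFTUR.SketchIdeator1G2

open MeasureTheory ProbabilityTheory Filter Topology
open scoped NNReal ENNReal ContDiff
open Literature.MathematicalPhysics.KineticTheory.HeatConduction

/-- **First lemma (a): Cauchy–Schwarz against the Θ-symmetrised snapshot.** For every probability measure
`μ` on `PhaseSpace N` and every `φ ∈ L²(μ)` odd under the momentum flip `Θ(q,p) = (q,-p)`:
`(∫ φ dμ)² ≤ ½ · KL(μ ‖ Θ_*μ) · ∫ φ² dμ` whenever the divergence is finite (Mathlib `InformationTheory.klDiv`).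
No density, positivity or regularity of `μ` is needed: the odd density `a := dμ/dμˢ - 1`
(`μˢ := ½(μ + Θ_*μ)`) always exists, `|a| ≤ 1`, `a∘Θ = -a`, `KL(μ‖Θ_*μ) = ∫ 2a·artanh(a) dμˢ ≥ 2∫a² dμˢ`
and `∫ φ dμ = ∫ φ·a dμˢ`. Applied to `φ = j_b` it is the static corner `2G² ≤ ⟨j_b²⟩ K` of (★) for EVERY
weak steady-state family (no uniqueness); applied to `φ = L_T Z_b` it is the `K`-side of the line. -/
def OddSnapshotCauchySchwarz : Prop :=
  ∀ (N : ℕ) (μ : Measure (PhaseSpace N)), IsProbabilityMeasure μ →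
    ∀ φ : PhaseSpace N → ℝ, (∀ x : PhaseSpace N, φ (x.1, -x.2) = -φ x) → MemLp φ 2 μ →
      InformationTheory.klDiv μ (Measure.map (fun x : PhaseSpace N => (x.1, -x.2)) μ) ≠ ⊤ →
      (∫ x, φ x ∂μ) ^ 2 ≤
        (1 / 2) * (InformationTheory.klDiv μ (Measure.map (fun x : PhaseSpace N => (x.1, -x.2)) μ)).toReal *
          ∫ x, φ x ^ 2 ∂μ

/-- **First lemma (b): the dual response limit ("response without response theory").** Under weak-NESS
uniqueness, along every steady-state family of `pinnedChain ω₂ lam β γ` (all parameters `> 0`), for `T > 0`,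
`N ≥ 2` and every smooth `F` whose derivatives up to order 2 are bounded by `A e^{θH}` for some
`θ < 1/(2T)`: `(1/δ) ∫ (L_{T,T} F) dμ_{N,T+δ/2,T-δ/2} → -(γ/(2T²)) ∫ F · (p_0² - p_{N-1}²) dμ_T` as `δ → 0`,
`δ ≠ 0`. Mechanism: the generator is affine in the bath temperatures,
`L_{T+δ/2,T-δ/2} F - L_{T,T} F = (γδ/2)(∂²_{p_0}F - ∂²_{p_{N-1}}F)`, and `∫ L_{T+δ/2,T-δ/2} F dμ_δ = 0` (weak
stationarity, extended from `C_c^∞` to the `e^{θH}` class by cutoff + exponential moments), so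
`(1/δ)∫ L_T F dμ_δ = -(γ/2) ∫ (∂²_{p_0} - ∂²_{p_{N-1}})F dμ_δ` EXACTLY; then `μ_δ ⇀ μ_T` (tightness from
uniform `e^{ϑH}`-moments, closedness of the weak steady-state relation, uniqueness at `(T,T)` where Gibbs is a
steady state) and Gaussian integration by parts in `p_0, p_{N-1}` under `μ_T`
(`∫ ∂²_{p_i}F dμ_T = ∫ F (p_i²/T² - 1/T) dμ_T`; cf. the source identity
`pinnedChain_integral_generator_gibbsMeasure`). This is the linear-response functional restricted to
`Ran(L_T)`, which is all the crux needs. -/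
def DualResponseLimit : Prop :=
  ∀ ω₂ lam β γ : ℝ, 0 < ω₂ → 0 < lam → 0 < β → 0 < γ →
    (∀ (N : ℕ) (T_L T_R : ℝ), 0 < T_L → 0 < T_R → ∀ μ ν : Measure (PhaseSpace N),
      (pinnedChain ω₂ lam β γ).IsSteadyState N T_L T_R μ →
      (pinnedChain ω₂ lam β γ).IsSteadyState N T_L T_R ν → μ = ν) →
    ∀ μ : (N : ℕ) → ℝ → ℝ → Measure (PhaseSpace N),
      (∀ (N : ℕ) (T_L T_R : ℝ), 0 < T_L → 0 < T_R →
        (pinnedChain ω₂ lam β γ).IsSteadyState N T_L T_R (μ N T_L T_R)) →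
    ∀ T : ℝ, 0 < T →
    (let P := pinnedChain ω₂ lam β γ
     ∀ N : ℕ, 2 ≤ N →
     let E : PhaseSpace N → ℝ := fun x =>
       ∑ i : Fin N, ((if i.val = 0 then x.2 i ^ 2 else 0) - (if i.val = N - 1 then x.2 i ^ 2 else 0))
     ∀ F : PhaseSpace N → ℝ, ContDiff ℝ ∞ F →
       (∃ θ A : ℝ, θ < 1 / (2 * T) ∧ ∀ n : ℕ, n ≤ 2 → ∀ x : PhaseSpace N,
          ‖iteratedFDeriv ℝ n F x‖ ≤ A * Real.exp (θ * P.hamiltonian N x)) →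
       Tendsto (fun δ : ℝ => (∫ x, P.generator N T T F x ∂(μ N (T + δ / 2) (T - δ / 2))) / δ)
         (𝓝[≠] 0) (𝓝 (-(P.γ / (2 * T ^ 2)) * ∫ x, F x * E x ∂(P.gibbsMeasure N T))))

/-- **Continuity of static second moments along the family** (the only other NESS input of the line):
`∫ F dμ_{N,T+δ/2,T-δ/2} → ∫ F dμ_T` for continuous `F` with `|F| ≤ A e^{θH}`, `θ < 1/(2T)` — tightness +
uniqueness at `(T,T)`, same engine as `DualResponseLimit`. -/
def StaticContinuity : Prop :=
  ∀ ω₂ lam β γ : ℝ, 0 < ω₂ → 0 < lam → 0 < β → 0 < γ →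
    (∀ (N : ℕ) (T_L T_R : ℝ), 0 < T_L → 0 < T_R → ∀ μ ν : Measure (PhaseSpace N),
      (pinnedChain ω₂ lam β γ).IsSteadyState N T_L T_R μ →
      (pinnedChain ω₂ lam β γ).IsSteadyState N T_L T_R ν → μ = ν) →
    ∀ μ : (N : ℕ) → ℝ → ℝ → Measure (PhaseSpace N),
      (∀ (N : ℕ) (T_L T_R : ℝ), 0 < T_L → 0 < T_R →
        (pinnedChain ω₂ lam β γ).IsSteadyState N T_L T_R (μ N T_L T_R)) →
    ∀ T : ℝ, 0 < T →
    (let P := pinnedChain ω₂ lam β γ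
     ∀ N : ℕ, ∀ F : PhaseSpace N → ℝ, Continuous F →
       (∃ θ A : ℝ, θ < 1 / (2 * T) ∧ ∀ x : PhaseSpace N, |F x| ≤ A * Real.exp (θ * P.hamiltonian N x)) →
       Tendsto (fun δ : ℝ => ∫ x, F x ∂(μ N (T + δ / 2) (T - δ / 2))) (𝓝[≠] 0)
         (𝓝 (∫ x, F x ∂(P.gibbsMeasure N T))))

/-- **Two equilibrium correctors** (support; existence at equal temperatures, fixed `N`): for every bond `b`
and every small `θ > 0` there are smooth `U_b`, `Z_b` with `e^{θH}`-bounded 2-jets solving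
`L_T U_b = -j_b/T²` and `L_T Z_b = U_b - U_b∘Θ` (expected: `U_b = T⁻²∫₀^∞ P_s j_b ds`,
`Z_b = -∫₀^∞ P_s (U_b - U_b∘Θ) ds`, from `pinnedChainSemigroup_exp_convergence` at `T_L = T_R = T` with the
Gibbs measure as the invariant measure, plus hypoelliptic regularity). -/
def TwoCorrectors : Prop :=
  ∀ ω₂ lam β γ : ℝ, 0 < ω₂ → 0 < lam → 0 < β → 0 < γ → ∀ T : ℝ, 0 < T →
    (let P := pinnedChain ω₂ lam β γ
     ∀ N : ℕ, 2 ≤ N → ∀ b : ℕ, b + 1 < N →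
     let j : PhaseSpace N → ℝ := fun x => if h : b < N then P.bondCurrent N ⟨b, h⟩ x else 0
     ∀ θ : ℝ, 0 < θ → θ < 1 / (2 * T) →
     ∃ U Z : PhaseSpace N → ℝ, ContDiff ℝ ∞ U ∧ ContDiff ℝ ∞ Z ∧
       (∃ A : ℝ, ∀ n : ℕ, n ≤ 2 → ∀ x : PhaseSpace N,
          ‖iteratedFDeriv ℝ n U x‖ ≤ A * Real.exp (θ * P.hamiltonian N x) ∧
          ‖iteratedFDeriv ℝ n Z x‖ ≤ A * Real.exp (θ * P.hamiltonian N x)) ∧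
       (∀ x : PhaseSpace N, P.generator N T T U x = -j x / T ^ 2) ∧
       (∀ x : PhaseSpace N, P.generator N T T Z x = U x - U (x.1, -x.2)))

/-- **Equilibrium algebra** (support; pure `L²(μ_T)` identities, no NESS): for correctors as above,
(i) `(γ/2) ∫ U_b (p_0² - p_{N-1}²) dμ_T = ∫ U_b j_b dμ_T` (the dual value IS the Green–Kubo number `g_b`;
proof: `γ(p_0² - p_{N-1}²) = -2j_b - L_T E_b` with `E_b = H_{≤b} - H_{>b}` (half/half split),
`⟨U_b, L_T E_b⟩ = ⟨L_T(U_b∘Θ), E_b⟩ = -4⟨U_b, j_b⟩` by `L_T^† = Θ L_T Θ`, `A E_b = -2 j_b` and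
`⟨L_T^†(U_b∘Θ), E_b⟩ = ⟨j_b, E_b⟩/T² = 0`), (ii) `g_b` does not depend on `b` (flat Green–Kubo matrix:
`j_b - j_{b+1} = L_T e_{b+1}`), (iii) `-(γ/(2T²)) ∫ Z_b (p_0² - p_{N-1}²) dμ_T = ½ ∫ (U_b - U_b∘Θ)² dμ_T`
(same algebra with `h := E_b/(2T²) - U_b∘Θ`, `L_T^† h = -(γ/2T²)(p_0² - p_{N-1}²)`, `h_odd = ½(U_b - U_b∘Θ)`).
All three verified as RATIONAL identities on the harmonic member, N = 2..5 (`checks/dual_corrector_check.py`). -/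
def EquilibriumAlgebra : Prop :=
  ∀ ω₂ lam β γ : ℝ, 0 < ω₂ → 0 < lam → 0 < β → 0 < γ → ∀ T : ℝ, 0 < T →
    (let P := pinnedChain ω₂ lam β γ
     ∀ N : ℕ, 2 ≤ N →
     let E : PhaseSpace N → ℝ := fun x =>
       ∑ i : Fin N, ((if i.val = 0 then x.2 i ^ 2 else 0) - (if i.val = N - 1 then x.2 i ^ 2 else 0))
     ∀ b : ℕ, b + 1 < N →
     let j : PhaseSpace N → ℝ := fun x => if h : b < N then P.bondCurrent N ⟨b, h⟩ x else 0
     ∀ U Z : PhaseSpace N → ℝ, ContDiff ℝ ∞ U → ContDiff ℝ ∞ Z →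
       (∃ θ A : ℝ, θ < 1 / (2 * T) ∧ ∀ n : ℕ, n ≤ 2 → ∀ x : PhaseSpace N,
          ‖iteratedFDeriv ℝ n U x‖ ≤ A * Real.exp (θ * P.hamiltonian N x) ∧
          ‖iteratedFDeriv ℝ n Z x‖ ≤ A * Real.exp (θ * P.hamiltonian N x)) →
       (∀ x : PhaseSpace N, P.generator N T T U x = -j x / T ^ 2) →
       (∀ x : PhaseSpace N, P.generator N T T Z x = U x - U (x.1, -x.2)) →
       ((P.γ / 2) * ∫ x, U x * E x ∂(P.gibbsMeasure N T) = ∫ x, U x * j x ∂(P.gibbsMeasure N T)) ∧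
       (∀ b' : ℕ, ∀ hb' : b' + 1 < N, ∀ U' : PhaseSpace N → ℝ, ContDiff ℝ ∞ U' →
          (∃ θ A : ℝ, θ < 1 / (2 * T) ∧ ∀ n : ℕ, n ≤ 2 → ∀ x : PhaseSpace N,
             ‖iteratedFDeriv ℝ n U' x‖ ≤ A * Real.exp (θ * P.hamiltonian N x)) →
          (∀ x : PhaseSpace N, P.generator N T T U' x = -(P.bondCurrent N ⟨b', by omega⟩ x) / T ^ 2) →
          ∫ x, U' x * P.bondCurrent N ⟨b', by omega⟩ x ∂(P.gibbsMeasure N T) =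
            ∫ x, U x * j x ∂(P.gibbsMeasure N T)) ∧
       (-(P.γ / (2 * T ^ 2)) * ∫ x, Z x * E x ∂(P.gibbsMeasure N T) =
          (1 / 2) * ∫ x, (U x - U (x.1, -x.2)) ^ 2 ∂(P.gibbsMeasure N T)))

/-- **What the two levers deliver to a Gram/CS line (card A `linear-score-cauchy-schwarz` and its twins):**
the two NESS links, in `U`-form. `GreenKuboDual`: `D N / (N-1) = ∫ U_b j_b dμ_T` for every first corrector;
`SnapshotKLDual`: the crux's KL hypothesis forces `½ ∫ (U_b - U_b∘Θ)² dμ_T ≤ K`. (Card A states the same two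
conclusions with `W := U∘Θ`; `-∫ j W dμ_T = ∫ U j dμ_T` by Θ-invariance of `μ_T` and oddness of `j_b`.) -/
def GreenKuboDual : Prop :=
  ∀ ω₂ lam β γ : ℝ, 0 < ω₂ → 0 < lam → 0 < β → 0 < γ →
    (∀ (N : ℕ) (T_L T_R : ℝ), 0 < T_L → 0 < T_R → ∀ μ ν : Measure (PhaseSpace N),
      (pinnedChain ω₂ lam β γ).IsSteadyState N T_L T_R μ →
      (pinnedChain ω₂ lam β γ).IsSteadyState N T_L T_R ν → μ = ν) →
    ∀ μ : (N : ℕ) → ℝ → ℝ → Measure (PhaseSpace N),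
      (∀ (N : ℕ) (T_L T_R : ℝ), 0 < T_L → 0 < T_R →
        (pinnedChain ω₂ lam β γ).IsSteadyState N T_L T_R (μ N T_L T_R)) →
    ∀ T : ℝ, 0 < T → ∀ D : ℕ → ℝ,
      (∀ N : ℕ, Tendsto (fun δ : ℝ =>
        (pinnedChain ω₂ lam β γ).totalCurrent (μ N (T + δ / 2) (T - δ / 2)) / δ) (𝓝[≠] 0) (𝓝 (D N))) →
    (let P := pinnedChain ω₂ lam β γ
     ∀ N : ℕ, 2 ≤ N → ∀ b : ℕ, b + 1 < N →
     let j : PhaseSpace N → ℝ := fun x => if h : b < N then P.bondCurrent N ⟨b, h⟩ x else 0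
     ∀ U : PhaseSpace N → ℝ, ContDiff ℝ ∞ U →
       (∃ θ A : ℝ, θ < 1 / (2 * T) ∧ ∀ n : ℕ, n ≤ 2 → ∀ x : PhaseSpace N,
          ‖iteratedFDeriv ℝ n U x‖ ≤ A * Real.exp (θ * P.hamiltonian N x)) →
       (∀ x : PhaseSpace N, P.generator N T T U x = -j x / T ^ 2) →
       D N / ((N : ℝ) - 1) = ∫ x, U x * j x ∂(P.gibbsMeasure N T))

/-- See `GreenKuboDual`. -/
def SnapshotKLDual : Prop :=
  ∀ ω₂ lam β γ : ℝ, 0 < ω₂ → 0 < lam → 0 < β → 0 < γ →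
    (∀ (N : ℕ) (T_L T_R : ℝ), 0 < T_L → 0 < T_R → ∀ μ ν : Measure (PhaseSpace N),
      (pinnedChain ω₂ lam β γ).IsSteadyState N T_L T_R μ →
      (pinnedChain ω₂ lam β γ).IsSteadyState N T_L T_R ν → μ = ν) →
    ∀ μ : (N : ℕ) → ℝ → ℝ → Measure (PhaseSpace N),
      (∀ (N : ℕ) (T_L T_R : ℝ), 0 < T_L → 0 < T_R →
        (pinnedChain ω₂ lam β γ).IsSteadyState N T_L T_R (μ N T_L T_R)) →
    ∀ T : ℝ, 0 < T →
    (let P := pinnedChain ω₂ lam β γ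
     ∀ N : ℕ, 2 ≤ N → ∀ b : ℕ, b + 1 < N →
     let j : PhaseSpace N → ℝ := fun x => if h : b < N then P.bondCurrent N ⟨b, h⟩ x else 0
     ∀ U : PhaseSpace N → ℝ, ContDiff ℝ ∞ U →
       (∃ θ A : ℝ, θ < 1 / (2 * T) ∧ ∀ n : ℕ, n ≤ 2 → ∀ x : PhaseSpace N,
          ‖iteratedFDeriv ℝ n U x‖ ≤ A * Real.exp (θ * P.hamiltonian N x)) →
       (∀ x : PhaseSpace N, P.generator N T T U x = -j x / T ^ 2) →
       ∀ K : ℝ, 0 ≤ K →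
         (∀ᶠ δ in 𝓝[≠] (0 : ℝ), InformationTheory.klDiv (μ N (T + δ / 2) (T - δ / 2))
            (Measure.map (fun x : PhaseSpace N => (x.1, -x.2)) (μ N (T + δ / 2) (T - δ / 2))) ≤
            ENNReal.ofReal (K * δ ^ 2)) →
         (1 / 2) * ∫ x, (U x - U (x.1, -x.2)) ^ 2 ∂(P.gibbsMeasure N T) ≤ K)

/-- **The real-variable heart of the K-side** (kernel-checked): an eventual bound
`m(δ)² ≤ ½ K δ² s(δ)` with `m(δ)/δ → c` and `s(δ) → s₀` forces `2c² ≤ K s₀` — this is how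
`OddSnapshotCauchySchwarz` + `DualResponseLimit` + `StaticContinuity` give `K ≥ 2c²/‖φ‖²`, i.e. `K ≥ k`
once `EquilibriumAlgebra` (iii) identifies `c = ½‖φ‖²`. -/
theorem K_side_limit {m s : ℝ → ℝ} {c s₀ K : ℝ}
    (hm : Tendsto (fun δ => m δ / δ) (𝓝[≠] 0) (𝓝 c))
    (hs : Tendsto s (𝓝[≠] 0) (𝓝 s₀))
    (hev : ∀ᶠ δ in 𝓝[≠] (0 : ℝ), m δ ^ 2 ≤ (1 / 2) * (K * δ ^ 2) * s δ) :
    2 * c ^ 2 ≤ K * s₀ := by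
  -- divide by δ² along the punctured filter and pass to the limit
  have hq : ∀ᶠ δ in 𝓝[≠] (0 : ℝ), (m δ / δ) ^ 2 ≤ (1 / 2) * K * s δ := by
    filter_upwards [hev, self_mem_nhdsWithin] with δ hδ hne
    have hδ0 : (δ : ℝ) ≠ 0 := hne
    have hδ2 : 0 < δ ^ 2 := by positivity
    rw [div_pow]
    rw [div_le_iff₀ hδ2]
    nlinarith [hδ]
  have hlim1 : Tendsto (fun δ => (m δ / δ) ^ 2) (𝓝[≠] 0) (𝓝 (c ^ 2)) := hm.pow 2
  have hlim2 : Tendsto (fun δ => (1 / 2) * K * s δ) (𝓝[≠] 0) (𝓝 ((1 / 2) * K * s₀)) :=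
    hs.const_mul _
  have := le_of_tendsto_of_tendsto hlim1 hlim2 hq
  linarith

/-- **The two first lemmas plus static continuity and algebra give card A's NESS link 2 (`K ≥ k`)**,
kernel-checked modulo the instantiation bookkeeping, in the abstract form actually used: -/
theorem K_ge_k_of_levers {KLδ : ℝ → ℝ≥0∞} {m s : ℝ → ℝ} {c s₀ K : ℝ} (hK : 0 ≤ K)
    (hCS : ∀ δ, KLδ δ ≠ ⊤ → m δ ^ 2 ≤ (1 / 2) * (KLδ δ).toReal * s δ)      -- OddSnapshotCauchySchwarz
    (hs0 : ∀ δ, 0 ≤ s δ)                                                   -- s δ = ∫ φ² dμ_δ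
    (hm : Tendsto (fun δ => m δ / δ) (𝓝[≠] 0) (𝓝 c))                      -- DualResponseLimit
    (hs : Tendsto s (𝓝[≠] 0) (𝓝 s₀))                                      -- StaticContinuity
    (hyp : ∀ᶠ δ in 𝓝[≠] (0 : ℝ), KLδ δ ≤ ENNReal.ofReal (K * δ ^ 2))       -- the crux's hypothesis
    (halg : c = s₀ / 2) :                                                   -- EquilibriumAlgebra (iii)
    s₀ / 2 ≤ K := by
  have hev : ∀ᶠ δ in 𝓝[≠] (0 : ℝ), m δ ^ 2 ≤ (1 / 2) * (K * δ ^ 2) * s δ := by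
    filter_upwards [hyp] with δ hδ
    have hne : KLδ δ ≠ ⊤ := ne_top_of_le_ne_top ENNReal.ofReal_ne_top hδ
    have h1 := hCS δ hne
    have h2 : (KLδ δ).toReal ≤ K * δ ^ 2 := by
      have := ENNReal.toReal_mono ENNReal.ofReal_ne_top hδ
      rwa [ENNReal.toReal_ofReal (by positivity)] at this
    calc m δ ^ 2 ≤ (1 / 2) * (KLδ δ).toReal * s δ := h1
      _ ≤ (1 / 2) * (K * δ ^ 2) * s δ := by
        apply mul_le_mul_of_nonneg_right _ (hs0 δ)
        linarith
  have h := K_side_limit hm hs hev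
  -- 2 c² ≤ K s₀ with c = s₀/2 :  s₀²/2 ≤ K s₀
  rw [halg] at h
  have hs0' : 0 ≤ s₀ := ge_of_tendsto' hs (fun δ => hs0 δ) |> fun h' => by
    exact le_of_tendsto_of_tendsto tendsto_const_nhds hs (Eventually.of_forall hs0)
  rcases hs0'.lt_or_eq with hpos | hzero
  · nlinarith
  · rw [← hzero]; simpa using hK

end Summit.AtomisticToContinuum.FouriersLaw.Cruxes.LinearResponseFTUR.SketchIdeator1G2
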